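import Summits.ABC.IUTFork.Cor312LicenceWildInhabitedTriple
import Summits.ABC.IUTFork.Conditional.WRowFrey343Packages
import HarnessLib

/-!
# [IUTchIII] Cor. 3.12, branch C / R-W W1 — the abc-TRIPLE bridge, v2: the row's arithmetic is demanded only at primes that CARRY
# a bad fibre point — so the tame ramification indices can be READ OFF the datum and pinned by the tree's divisibilities

PROOF-ONLY file (D-0012; 0 definitions, 0 `Prop` facts) of the abc-iut cell — D-0079 RESCUE sub-cell R-W «WINDOW Θ-SIDE INEQUALITY», W1 ROW
DECISIONS (inhabited side, D-0107), seat abc-iut-W-row-2 gen 0; sequel of `Cor312LicenceWildInhabitedTriple` (p476012) over abc-iut-W-row-1's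
socket (p470548 / `…GenuineK`). TAKES NO SIDE on [IUTchIII] Cor. 3.12 or on any author; «inhabited as typed» ≠ «asserted in print».

WHY. The v1 bridge leaves, per bad prime `p`, ONE binder: the common absolute ramification index `e_p` of the completions at the bad fibre
points. At the TAME bad primes (`p ∉ {2, 3, 5, l}`) the tree pins `e(K_x/ℚ_p)` two-sidedly up to a finite set (`e ∣ 60·l`, abc-iut-W-neg-1
`GenuineK.absRamificationIdx_kOf_dvd_ratPoint`; `l ∣ e`, `15·l ∣ e·t`, abc-iut-W-neg-2 `Cor312GenuineKWildLowerBound`), and the R-W rows hold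
for EVERY member of that set (this seat's row files). To DISCHARGE the binder one needs (a) that `e(K_x/ℚ_p)` does not depend on the bad fibre
point `x | p` — so that `e_p := e(K_{x₀}/ℚ_p)` read off any one point serves the socket — and (b) a bridge whose arithmetic hypothesis is only
demanded where a bad fibre point EXISTS (to read it off). (a) is the W1 composers' `WRow.absRamificationIdx_kOf_eq_of_finrank_eq_one`
(`Conditional/WRowFrey343Packages.lean`, over this seat's conjugacy lemma); this file supplies (b).

WHAT IS PROVED (namespace `Summit.ABC.IUTFork.Cor312Prov`).
* **`licence_settingPrVolSharp_pilotDataOfK_triple_of_bad`** / **`exists_qPinned_and_hull_settingPrVolSharp_pilotDataOfK_triple_of_bad`** —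
  v1's bridge with `harith` receiving, besides `p ∣ abc`, `p ≠ 2`, `p ≠ l`, a BAD FIBRE POINT over `p`.
HONEST SCOPE as in v1: OUR sharp containers; STRONGER-THAN-PRINT hull licence; nothing about the printed inequality or the existence of initial
Θ-data; typed ≠ proved; instantiated ≠ endorsed. [cite: Mochizuki2012, IUTchI Def. 3.1 (b),(c) pp. 61–62, Rmk. 3.1.5 p. 65; IUTchIII Cor. 3.12
Step (xi-f) p. 184; IUTchIV Cor. 2.2 (ii) proof p. 44–46] [cite: DupuyHilado2025, §3.3, §3.4, §4.9, §4.12] [cite: CasselsFrohlichANT1967, Ch. VII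
Prop. 1.2 (ii)] [cite: NeukirchANT1999, Ch. II (5.5), (6.8)] [claim: Mochizuki2012, status: disputed] for every IUT sentence quoted.
-/

noncomputable section

open Set Metric Function NumberField IsDedekindDomain
open scoped Pointwise

namespace Summit.ABC.IUTFork.Cor312Prov

open Thm311 Thm311.Real Cor312 Cor312.Setting Cor312Vol Literature.IUT.LogThetaLattice Literature.IUT.LogVolume
  Literature.IUT.HodgeTheaters
open Literature.NumberTheory.NumberFields Literature.NumberTheory.GaloisRepresentations.Ultrametric
open Literature.NumberTheory.DiophantineGeometry Literature.NumberTheory.DiophantineGeometry.GenEll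

variable {F K Fbar : Type} [Field F] [NumberField F] [Field K] [NumberField K] [Algebra F K] [Field Fbar]
  [Algebra F Fbar] [Algebra K Fbar] {E : WeierstrassCurve F} [E.IsElliptic] {l : ℕ} {Pb : BadPlacePredicates K}
  (D : InitialThetaData F K Fbar E l Pb)

/-! ## The bridge with the arithmetic demanded only at primes carrying a bad fibre point -/

variable {logv : PadicLogs K} (hlog : LogvAnalytic logv)
  (M : Type) [Field M] [NumberField M]
  (archPk : ∀ (j : (thetaIndex (pilotDataOfK D K)).Label) (vQ : (thetaIndex (pilotDataOfK D K)).VQ),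
    Set ((logShellsDH (pilotDataOfK D K) logv).Packet j vQ))
  (archSub : ∀ (j : (thetaIndex (pilotDataOfK D K)).Label) (v : (thetaIndex (pilotDataOfK D K)).V),
    Set ((logShellsDH (pilotDataOfK D K) logv).Packet j ((thetaIndex (pilotDataOfK D K)).over v)))
  (Ψ : ℤ → ∀ v : (thetaIndex (pilotDataOfK D K)).V, v ∈ (thetaIndex (pilotDataOfK D K)).Vbad →
    Set ((logShellsDH (pilotDataOfK D K) logv).StarPacket v))
  (act : ℤ → ∀ v : (thetaIndex (pilotDataOfK D K)).V, v ∈ (thetaIndex (pilotDataOfK D K)).Vbad →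
    (logShellsDH (pilotDataOfK D K) logv).StarPacket v → Module.End ℚ ((logShellsDH (pilotDataOfK D K) logv).StarPacket v))
  (Mmod : ℤ → ∀ j : (thetaIndex (pilotDataOfK D K)).LabelStar, Set ((logShellsDH (pilotDataOfK D K) logv).GlobalPacket j.1))
  (region : ℤ → ∀ j : (thetaIndex (pilotDataOfK D K)).LabelStar, FinDivisor M → ∀ vQ : (thetaIndex (pilotDataOfK D K)).VQ,
    Set ((logShellsDH (pilotDataOfK D K) logv).Packet j.1 vQ))
  (n : ℤ) {HT : Type} {LogLink : HT → HT → Type} {IsFull : ∀ {s t : HT}, LogLink s t → Prop}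
  (lat : LGPGaussianLogThetaLattice LogLink IsFull)
  {Frd : Type} {IsoF : Frd → Frd → Type} {Ob : Frd → Type} {realify : Frd → Frd} {Strip : Type}
  {IsoS : Strip → Strip → Type} {Mv : ∀ v : (thetaIndex (pilotDataOfK D K)).V, v ∈ (thetaIndex (pilotDataOfK D K)).Vbad → Type}
  [∀ v h, Monoid (Mv v h)]
  (sig : GlobalLGPFrobenioidSignature (thetaIndex (pilotDataOfK D K)).lstar (thetaIndex (pilotDataOfK D K)).V
    (· ∈ (thetaIndex (pilotDataOfK D K)).Vbad) Frd IsoF Ob realify Strip IsoS Mv)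
  (split : SplittingMonoids Mv) {ObΔ : Type} {N : ∀ v : (thetaIndex (pilotDataOfK D K)).V, v ∈ (thetaIndex (pilotDataOfK D K)).Vbad → Type}
  [∀ v h, Monoid (N v h)] (qData : QPilotData ObΔ N)
  (tq : ∀ (pp : Nat.Primes) (x : (thetaIndex (pilotDataOfK D K)).Fibre (.inr pp)),
    haveI : Fact (pp : ℕ).Prime := ⟨pp.2⟩; kOf (pilotDataOfK D K) pp.1 x)
  (t : ∀ (pp : Nat.Primes) (_ : Fin (pilotDataOfK D K).lstar) (x : (thetaIndex (pilotDataOfK D K)).Fibre (.inr pp)),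
    haveI : Fact (pp : ℕ).Prime := ⟨pp.2⟩; kOf (pilotDataOfK D K) pp.1 x)
  (htq0 : ∀ pp x, tq pp x ≠ 0)
  (htq1 : ∀ (pp : Nat.Primes) (x : (thetaIndex (pilotDataOfK D K)).Fibre (.inr pp)),
    haveI : Fact (pp : ℕ).Prime := ⟨pp.2⟩; placeOf (pilotDataOfK D K) pp.1 x ∉ (pilotDataOfK D K).S → ‖tq pp x‖ = 1)
  (col : ℤ → Column (logShellsDH (pilotDataOfK D K) logv))
  (ht0 : ∀ pp i x, t pp i x ≠ 0)
  (ht : ∀ (pp : Nat.Primes) (i : Fin (pilotDataOfK D K).lstar) (x : (thetaIndex (pilotDataOfK D K)).Fibre (.inr pp)),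
    haveI : Fact (pp : ℕ).Prime := ⟨pp.2⟩
    Real.log ‖t pp i x‖ = -((pilotDataOfK D K).thetaPilot i (placeOf (pilotDataOfK D K) pp.1 x)) *
      logNorm K (placeOf (pilotDataOfK D K) pp.1 x) / localDegree K (placeOf (pilotDataOfK D K) pp.1 x))
  (htq : ∀ (pp : Nat.Primes) (x : (thetaIndex (pilotDataOfK D K)).Fibre (.inr pp)),
    haveI : Fact (pp : ℕ).Prime := ⟨pp.2⟩
    Real.log ‖tq pp x‖ = -((pilotDataOfK D K).qPilot (placeOf (pilotDataOfK D K) pp.1 x)) *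
      logNorm K (placeOf (pilotDataOfK D K) pp.1 x) / localDegree K (placeOf (pilotDataOfK D K) pp.1 x))

include ht0 ht htq in
/-- **The licence at the `K`-level datum of an abc triple — arithmetic demanded only at primes WITH A BAD FIBRE POINT** (v2 of
`licence_settingPrVolSharp_pilotDataOfK_triple`: `harith` receives, besides `p ∣ abc`, `p ≠ 2`, `p ≠ l`, a bad fibre point `x | p`, so that a
consumer may take `e_p := e(K_x/ℚ_p)` READ OFF THE DATUM and feed the tree's two-sided divisibilities of that number). Everything else as in v1.
[cite: Mochizuki2012, IUTchI Def. 3.1 (b),(c) pp. 61–62; IUTchIII Cor. 3.12 Step (xi-f) p. 184; IUTchIV Cor. 2.2 (ii) proof p. 44–46]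
[cite: DupuyHilado2025, §3.3, §3.4, §4.9, §4.12] [claim: Mochizuki2012, status: disputed] -/
theorem licence_settingPrVolSharp_pilotDataOfK_triple_of_bad {a b c : ℕ} (habc : IsABCTriple a b c)
    (hj : E.j = ((Cor22.jInv ((a : ℚ) / c) : ℚ) : F)) (hF : Module.finrank ℚ (fieldOfModuli E) = 1) (e Dd a0 : Nat.Primes → ℕ)
    (hloc : ∀ (pp : Nat.Primes) (x : (thetaIndex (pilotDataOfK D K)).Fibre (.inr pp)),
      haveI : Fact (pp : ℕ).Prime := ⟨pp.2⟩
      placeOf (pilotDataOfK D K) pp.1 x ∈ (pilotDataOfK D K).S →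
        absRamificationIdx (pp : ℕ) (kOf (pilotDataOfK D K) pp.1 x) = e pp ∧
        (Dd pp : ℝ) / (e pp : ℝ) ≤ differentOrd (pp : ℕ) (kOf (pilotDataOfK D K) pp.1 x))
    (harith : ∀ pp : Nat.Primes, (pp : ℕ) ∣ a * b * c → (pp : ℕ) ≠ 2 → (pp : ℕ) ≠ l →
      (haveI : Fact (pp : ℕ).Prime := ⟨pp.2⟩
       ∃ x : (thetaIndex (pilotDataOfK D K)).Fibre (.inr pp), placeOf (pilotDataOfK D K) pp.1 x ∈ (pilotDataOfK D K).S) →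
      (∀ a' < a0 pp, ((pp : ℕ) : ℤ) ^ a' * (((pp : ℕ) : ℤ) - 1) < e pp) ∧ ((e pp : ℤ) < ((pp : ℕ) : ℤ) ^ (a0 pp) * (((pp : ℕ) : ℤ) - 1)) ∧
      2 * l ∣ e pp * (2 * (a * b * c).factorization pp) ∧
      ∀ i : Fin (pilotDataOfK D K).lstar,
        (e pp : ℤ) * (((((i : ℕ) + 1 : ℕ) : ℤ) ^ 2 * ((e pp * (2 * (a * b * c).factorization pp) / (2 * l) : ℕ) : ℤ) -
            (((i : ℕ) + 1 : ℕ) : ℤ) * (Dd pp : ℤ) - (((i : ℕ) + 2 : ℕ) : ℤ) * (1 : ℤ)) / (e pp : ℤ)) +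
          (((i : ℕ) + 2 : ℕ) : ℤ) * (((pp : ℕ) : ℤ) ^ (a0 pp) - (e pp : ℤ) * (a0 pp : ℤ)) ≤
            ((e pp * (2 * (a * b * c).factorization pp) / (2 * l) : ℕ) : ℤ)) :
    Thm311ToCor312.Licence
      (settingPrVolSharp (pilotDataOfK D K) hlog M archPk archSub Ψ act Mmod region n lat sig split qData tq t htq0 htq1) := by
  refine licence_settingPrVolSharp_pilotDataOfK_of_orders_rat D hlog M archPk archSub Ψ act Mmod region n lat sig split qData tq t htq0 htq1
    ht0 ht htq (Cor22.jInv ((a : ℚ) / c)) hj e Dd (fun pp => 2 * (a * b * c).factorization pp) (fun _ => 1)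
    (fun pp => ((pp : ℕ) : ℤ) ^ (a0 pp) - (e pp : ℤ) * (a0 pp : ℤ)) (fun pp x hx => ?_)
    (fun pp x y _ _ => nonempty_algEquiv_kOf_of_finrank_eq_one D hF pp x y) (fun pp hbad => ?_)
  · haveI : Fact (pp : ℕ).Prime := ⟨pp.2⟩
    obtain ⟨he, hD⟩ := hloc pp x hx
    have hdvd := natCast_dvd_of_placeOf_mem_S_triple D habc hj pp x hx
    obtain ⟨h2, hl⟩ := ne_two_and_ne_l_of_placeOf_mem_S_pilotDataOfK D pp x hx
    obtain ⟨hlo, hhi, hdiv, -⟩ := harith pp hdvd h2 hl ⟨x, hx⟩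
    refine ⟨he, hD, exists_not_mem_logUnits_norm_le_rpow_one (pp : ℕ) (e pp),
      exists_mem_logUnits_rpow_le_of_turning (pp : ℕ) he hlo hhi, ?_, hdiv⟩
    rw [Cor22.ord_jInv_ratPoint_triple_eq habc _ (by rw [natGenerator_finBelow_placeOf D pp x]; exact h2)
      (by rw [natGenerator_finBelow_placeOf D pp x]; exact hdvd), natGenerator_finBelow_placeOf D pp x]
    push_cast
    ring
  · haveI : Fact (pp : ℕ).Prime := ⟨pp.2⟩
    obtain ⟨x, hx⟩ := hbad
    have hdvd := natCast_dvd_of_placeOf_mem_S_triple D habc hj pp x hx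
    obtain ⟨h2, hl⟩ := ne_two_and_ne_l_of_placeOf_mem_S_pilotDataOfK D pp x hx
    exact (harith pp hdvd h2 hl ⟨x, hx⟩).2.2.2

include ht0 ht htq in
/-- **Branch C's antecedent at the `K`-level datum of an abc triple — arithmetic demanded only at primes with a bad fibre point** (v2 of
`exists_qPinned_and_hull_settingPrVolSharp_pilotDataOfK_triple`, any columns). [cite: Mochizuki2012, IUTchIII Cor. 3.12 Step (xi-d) p. 183, (xi-f) p. 184]
[cite: DupuyHilado2025, §3.3, §3.4, §4.9] [claim: Mochizuki2012, status: disputed] -/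
theorem exists_qPinned_and_hull_settingPrVolSharp_pilotDataOfK_triple_of_bad {a b c : ℕ} (habc : IsABCTriple a b c)
    (hj : E.j = ((Cor22.jInv ((a : ℚ) / c) : ℚ) : F)) (hF : Module.finrank ℚ (fieldOfModuli E) = 1) (e Dd a0 : Nat.Primes → ℕ)
    (hloc : ∀ (pp : Nat.Primes) (x : (thetaIndex (pilotDataOfK D K)).Fibre (.inr pp)),
      haveI : Fact (pp : ℕ).Prime := ⟨pp.2⟩
      placeOf (pilotDataOfK D K) pp.1 x ∈ (pilotDataOfK D K).S →
        absRamificationIdx (pp : ℕ) (kOf (pilotDataOfK D K) pp.1 x) = e pp ∧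
        (Dd pp : ℝ) / (e pp : ℝ) ≤ differentOrd (pp : ℕ) (kOf (pilotDataOfK D K) pp.1 x))
    (harith : ∀ pp : Nat.Primes, (pp : ℕ) ∣ a * b * c → (pp : ℕ) ≠ 2 → (pp : ℕ) ≠ l →
      (haveI : Fact (pp : ℕ).Prime := ⟨pp.2⟩
       ∃ x : (thetaIndex (pilotDataOfK D K)).Fibre (.inr pp), placeOf (pilotDataOfK D K) pp.1 x ∈ (pilotDataOfK D K).S) →
      (∀ a' < a0 pp, ((pp : ℕ) : ℤ) ^ a' * (((pp : ℕ) : ℤ) - 1) < e pp) ∧ ((e pp : ℤ) < ((pp : ℕ) : ℤ) ^ (a0 pp) * (((pp : ℕ) : ℤ) - 1)) ∧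
      2 * l ∣ e pp * (2 * (a * b * c).factorization pp) ∧
      ∀ i : Fin (pilotDataOfK D K).lstar,
        (e pp : ℤ) * (((((i : ℕ) + 1 : ℕ) : ℤ) ^ 2 * ((e pp * (2 * (a * b * c).factorization pp) / (2 * l) : ℕ) : ℤ) -
            (((i : ℕ) + 1 : ℕ) : ℤ) * (Dd pp : ℤ) - (((i : ℕ) + 2 : ℕ) : ℤ) * (1 : ℤ)) / (e pp : ℤ)) +
          (((i : ℕ) + 2 : ℕ) : ℤ) * (((pp : ℕ) : ℤ) ^ (a0 pp) - (e pp : ℤ) * (a0 pp : ℤ)) ≤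
            ((e pp * (2 * (a * b * c).factorization pp) / (2 * l) : ℕ) : ℤ)) :
    ∃ (ρ' : (∀ v : (thetaIndex (pilotDataOfK D K)).V, v ∈ (thetaIndex (pilotDataOfK D K)).Vbad →
            Set ((logShellsDH (pilotDataOfK D K) logv).StarPacket v)) →
          ∀ (j : (thetaIndex (pilotDataOfK D K)).Label) (vQ : (thetaIndex (pilotDataOfK D K)).VQ),
            Set ((logShellsDH (pilotDataOfK D K) logv).Packet j vQ))
        (qK : ∀ v : (thetaIndex (pilotDataOfK D K)).V, v ∈ (thetaIndex (pilotDataOfK D K)).Vbad →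
          Set ((logShellsDH (pilotDataOfK D K) logv).StarPacket v)),
        QPinned ({ toSituation := situationPrVol (pilotDataOfK D K) hlog M archPk archSub Ψ act Mmod region, col := col } :
            LatticeSituation (thetaIndex (pilotDataOfK D K)))
          (settingPrVolSharp (pilotDataOfK D K) hlog M archPk archSub Ψ act Mmod region n lat sig split qData tq t htq0 htq1) ρ' qK ∧
        PilotKummerCompatHull ({ toSituation := situationPrVol (pilotDataOfK D K) hlog M archPk archSub Ψ act Mmod region, col := col } :
            LatticeSituation (thetaIndex (pilotDataOfK D K)))
          (settingPrVolSharp (pilotDataOfK D K) hlog M archPk archSub Ψ act Mmod region n lat sig split qData tq t htq0 htq1) ρ' qK :=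
  (exists_qPinned_and_hull_settingPrVolSharp_iff_licence (pilotDataOfK D K) hlog M archPk archSub Ψ act Mmod region n lat sig split
    qData tq t htq0 htq1 col (fun pp x => norm_qIdele_le_one_of_realises (pilotDataOfK D K) tq htq0 htq pp x)).2
    (licence_settingPrVolSharp_pilotDataOfK_triple_of_bad D hlog M archPk archSub Ψ act Mmod region n lat sig split qData tq t htq0 htq1
      ht0 ht htq habc hj hF e Dd a0 hloc harith)

end Summit.ABC.IUTFork.Cor312Prov

end
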